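import Mathlib.AlgebraicGeometry.Morphisms.UniversallyInjective
import Mathlib.FieldTheory.Relrank
import Literature.AlgebraicGeometry.Motives.AbelianVarietyFrobeniusTwistVariety
import Literature.AlgebraicGeometry.Motives.RelFrobeniusFactorisation
import Literature.AlgebraicGeometry.Motives.CartierDivisorFrobeniusPullback
import Literature.AlgebraicGeometry.Motives.AbelianVarietyDegreeGrowth
import Literature.AlgebraicGeometry.Motives.AbelianVarietyKernelDimension
import Literature.AlgebraicGeometry.Motives.CyclesDimensionFunctionField
import Literature.FieldTheory.Separability.PDegreeSeparablyGenerated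
import HarnessLib

/-!
# The relative Frobenius of an abelian variety is an isogeny of degree `q^{dim}`

Layer `Literature/AlgebraicGeometry/Motives`, namespace `Literature.AlgebraicGeometry.Motives` (schemes over `k`)
and `….AbelianVariety`.  KERNEL ONLY: theorems; no definition, no instance, no named fact.  Cell `hodgecm-mathlib`
(D-0151), programme E2 (the height-one road to Shimura's `shimuraTaniyamaPair_degOne'`), piece **DEG (b)** of
A-p02's ROAD-E2 memo in the tree's abelian-variety spelling: for an abelian variety `A` over a field `k` of
exponential characteristic `p` and `q = pⁿ`,

* §1 `Spec Frobⁿ : Spec k → Spec k` is universally injective (radicial), hence so is its base change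
  `pr : X^{(q)} → X` (`universallyInjective_frobSpec`, `universallyInjective_twistFst`); when `k` is perfect
  `Frobⁿ` is an automorphism of `k` and `pr` is an ISOMORPHISM OF SCHEMES (the tree's `isIso_frobSpec`,
  `isIso_twistFst` of `Motives/RelFrobeniusFactorisation`) — not a `k`-isomorphism; the relative Frobenius
  `F_{X/k} : X → X^{(q)}` is a bijection on points
  (`relFrobeniusOver_base_bijective`: `pr ∘ F_{X/k} = F_X^{abs}` is the identity on points and `pr` is injective);
* §2 **`F_{A/k} : A → A^{(q)}` is an isogeny** (`isIsogeny_relFrobenius`): surjective (§1) between abelian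
  varieties of the same dimension (`dim_frobeniusTwist`, `isIsogeny_of_surjective_of_dim_eq`); in particular
  `F_{A/k}` and `pr` are dominant (`isDominant_toSchemeHom_relFrobenius`, `isDominant_twistFst` — the two
  hypotheses of `CartierDivisor.pullback_relFrobenius_twist_sameDivisor`);
* §3 on function fields `F_{A/k}^♯ ∘ pr^♯ = (f ↦ f^q)` (`functionFieldMap_relFrobenius_functionFieldMap_twistFst`);
* §4 `[K : K^{q}] = q^{trdeg_k K}` for a finitely generated field `K` over a perfect `k`
  (`finrank_fieldRange_iterateFrobenius_eq_pow`, from the tree's Matsumura Thm. 26.5 `[K : K^p] = p^{trdeg}` by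
  the tower `K ⊇ K^p ⊇ K^{p²} ⊇ …`);
* §5 **`deg F_{A/k} = q^{dim A}`** over a perfect field (`kerRank_relFrobenius`): the degree of an isogeny is the
  degree of the function-field extension (`IsIsogeny.kerRank_eq_finrank_functionFieldOver`), `pr^♯` is an
  isomorphism `K(A) ≅ K(A^{(q)})` carrying the extension `K(A) / F^♯ K(A^{(q)})` to `K(A) / K(A)^q`, and
  `trdeg_k K(A) = dim A` (`height_top_eq_trdeg`).

HC_CM is proved only modulo the printed citations until rung 0 closes; this file adds no hypothesis.

## References
* [Shimura1998] G. Shimura, *Abelian Varieties with Complex Multiplication and Modular Functions* (1998), §2.8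
  Prop. 6 (p. 16) and §18.6 proof of Thm. 18.6, p. 127 («the `p`-th power homomorphism `π : Ã → Ã^f`», «`ν(λ̃) = ν(λ) = N(𝔮) = pⁿ`»).
* [Milne2025] J. S. Milne, *Lectures on Étale Cohomology*, VI §13 Rem. 13.5 (the relative Frobenius is a
  universal homeomorphism; degree `q^{dim}`).
* [MumfordAV1970] D. Mumford, *Abelian Varieties*, §15 p. 146 (the Frobenius morphism is an isogeny of degree
  `p^g`).
* [Matsumura1987] H. Matsumura, *Commutative Ring Theory*, Thm. 26.5 (`[K : K^p] = p^{trdeg}` over a perfect field).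
-/

set_option autoImplicit false

noncomputable section

open CategoryTheory CategoryTheory.Limits AlgebraicGeometry

universe u

namespace Literature.AlgebraicGeometry.Motives

/-! ## §1 Radiciality of `Spec Frobⁿ` and of `pr : X^{(q)} → X`; bijectivity of `F_{X/k}` on points -/

section Scheme

variable (k : Type u) [Field k] (p : ℕ) [ExpChar k p] (n : ℕ)

/-- `g ↦ g ≫ Spec Frobⁿ` is injective on `K`-points of `Spec k`, for every field `K`: a `K`-point is `Spec ι`
for a ring map `ι : k → K`, and `ι ∘ Frobⁿ_k = Frobⁿ_K ∘ ι` with `Frobⁿ_K` injective. [cite: Milne2025, VI §13 Rem. 13.5 (p. 302)] -/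
theorem comp_frobSpec_injective (K : Type u) [Field K] :
    Function.Injective fun g : Spec (.of K) ⟶ Spec (.of k) => g ≫ frobSpec k p n := by
  intro g₁ g₂ h
  -- write `gᵢ = Spec ιᵢ`
  obtain ⟨ι₁, rfl⟩ : ∃ ι : CommRingCat.of k ⟶ CommRingCat.of K, Spec.map ι = g₁ :=
    ⟨Spec.preimage g₁, Spec.map_preimage g₁⟩
  obtain ⟨ι₂, rfl⟩ : ∃ ι : CommRingCat.of k ⟶ CommRingCat.of K, Spec.map ι = g₂ :=
    ⟨Spec.preimage g₂, Spec.map_preimage g₂⟩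
  haveI : ExpChar K p := expChar_of_injective_ringHom ι₁.hom.injective p
  have key : ∀ ι : CommRingCat.of k ⟶ CommRingCat.of K,
      Spec.map ι ≫ frobSpec k p n = Spec.map (CommRingCat.ofHom (iterateFrobenius K p n)) ≫ Spec.map ι := by
    intro ι
    change Spec.map ι ≫ Spec.map (CommRingCat.ofHom (iterateFrobenius k p n)) = _
    rw [← Spec.map_comp, ← Spec.map_comp]
    congr 1
    ext x
    change ι.hom (iterateFrobenius k p n x) = iterateFrobenius K p n (ι.hom x)
    rw [iterateFrobenius_def, iterateFrobenius_def, map_pow]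
  change Spec.map ι₁ ≫ frobSpec k p n = Spec.map ι₂ ≫ frobSpec k p n at h
  rw [key ι₁, key ι₂] at h
  -- cancel `Spec Frobⁿ_K` (a universally injective morphism? no: directly, `Spec` is fully faithful and
  -- `Frobⁿ_K` is injective, i.e. a monomorphism of rings — but we need to cancel it on the LEFT of `Spec.map ι`,
  -- i.e. on the RIGHT of `ι` in `CommRingCat`: `ι₁ ≫ Frobⁿ_K = ι₂ ≫ Frobⁿ_K` ⇒ `ι₁ = ι₂`).
  have h' : ι₁ ≫ CommRingCat.ofHom (iterateFrobenius K p n) = ι₂ ≫ CommRingCat.ofHom (iterateFrobenius K p n) := by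
    apply Spec.map_injective
    rw [Spec.map_comp, Spec.map_comp]
    exact h
  congr 1
  ext x
  have hx := congrArg (fun φ : CommRingCat.of k ⟶ CommRingCat.of K => φ.hom x) h'
  exact iterateFrobenius_inj K p n hx

/-- **`Spec Frobⁿ : Spec k → Spec k` is universally injective** (radicial). [cite: Milne2025, VI §13 Rem. 13.5 (p. 302)] -/
theorem universallyInjective_frobSpec : UniversallyInjective (frobSpec k p n) :=
  ((tfae_universallyInjective (frobSpec k p n)).out 1 0).mp (comp_frobSpec_injective k p n)

variable {k} (X : SchemeOver.{u} k)

/-- **`pr : X^{(q)} → X` is universally injective** (a base change of the radicial `Spec Frobⁿ`).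
[cite: Milne2025, VI §13 Rem. 13.5 (p. 302)] -/
theorem universallyInjective_twistFst : UniversallyInjective (twistFst p n X) := by
  haveI := universallyInjective_frobSpec k p n
  rw [twistFst_def]
  exact MorphismProperty.pullback_fst _ _ ‹_›

/-- `pr : X^{(q)} → X` is injective on points. [cite: Milne2025, VI §13 Rem. 13.5 (p. 302)] -/
theorem twistFst_injective : Function.Injective (twistFst p n X) := by
  haveI := universallyInjective_twistFst p n X
  exact (twistFst p n X).injective

/-- **`F_{X/k} : X → X^{(q)}` is a bijection on points**: `pr ∘ F_{X/k}` is the absolute Frobenius, the identity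
on points (`twistFst_relFrobeniusOver_apply`), and `pr` is injective. [cite: Milne2025, VI §13 Rem. 13.5 (p. 302)] -/
theorem relFrobeniusOver_base_bijective : Function.Bijective (relFrobeniusOver p n X).left := by
  refine ⟨fun x y hxy => ?_, fun y => ⟨twistFst p n X y, ?_⟩⟩
  · have h := congrArg (twistFst p n X) hxy
    rwa [twistFst_relFrobeniusOver_apply, twistFst_relFrobeniusOver_apply] at h
  · apply twistFst_injective p n X
    rw [twistFst_relFrobeniusOver_apply]

/-- `F_{X/k}` is surjective (as a morphism of schemes). [cite: Milne2025, VI §13 Rem. 13.5 (p. 302)] -/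
theorem surjective_relFrobeniusOver_left : Surjective (relFrobeniusOver p n X).left :=
  ⟨(relFrobeniusOver_base_bijective p n X).2⟩

end Scheme

/-! ## §2 `F_{A/k}` is an isogeny -/

namespace AbelianVariety

variable {k : Type u} [Field k] (p : ℕ) [ExpChar k p] (n : ℕ) (A : AbelianVariety k)

/-- `F_{A/k}` is surjective. [cite: MumfordAV1970, §15 (p. 146)] -/
theorem surjective_toSchemeHom_relFrobenius : Surjective (Hom.toSchemeHom (A.relFrobenius p n)) :=
  surjective_relFrobeniusOver_left p n A.X

/-- `F_{A/k}` is dominant. [cite: MumfordAV1970, §15 (p. 146)] -/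
theorem isDominant_toSchemeHom_relFrobenius : IsDominant (Hom.toSchemeHom (A.relFrobenius p n)) := by
  haveI := A.surjective_toSchemeHom_relFrobenius p n
  infer_instance

/-- `pr : A^{(q)} → A` is dominant: `F_{A/k} ≫ pr = F^{abs}` is the identity on points, so `pr` is surjective.
[cite: Milne2025, VI §13 Rem. 13.5 (p. 302)] -/
theorem isDominant_twistFst : IsDominant (twistFst p n A.X) := by
  have hs : Function.Surjective (twistFst p n A.X) := fun x =>
    ⟨Hom.toSchemeHom (A.relFrobenius p n) x, A.twistFst_relFrobenius_apply p n x⟩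
  exact ⟨hs.denseRange⟩

/-- **The relative `q`-Frobenius `F_{A/k} : A → A^{(q)}` is an isogeny** (surjective, and `dim A^{(q)} = dim A`).
[cite: MumfordAV1970, §15 (p. 146)] [cite: Shimura1998, §18.6 proof of Thm. 18.6, p. 127] -/
theorem isIsogeny_relFrobenius : IsIsogeny (A.relFrobenius p n) := by
  haveI := A.surjective_toSchemeHom_relFrobenius p n
  exact isIsogeny_of_surjective_of_dim_eq (A.relFrobenius p n) (A.dim_frobeniusTwist p n).symm

end AbelianVariety

/-! ## §3 On function fields: `F_{A/k}^♯ ∘ pr^♯ = (f ↦ f^q)` -/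

namespace AbelianVariety

open RatFn

variable {k : Type u} [Field k] (p : ℕ) [ExpChar k p] (n : ℕ) (A : AbelianVariety k)

/-- **`F_{A/k}^♯ (pr^♯ f) = f^q` on the function field `K(A)`**: `F_{A/k} ≫ pr` is the absolute `q`-Frobenius
(`toSchemeHom_relFrobenius_comp_twistFst`), which is `f ↦ f^q` on `K(A)` (`functionFieldMap_powEndo`).
[cite: Shimura1998, §18.6 proof of Thm. 18.6, p. 127] [cite: Hartshorne1977, IV §2 Rem. 2.4.1] -/
theorem functionFieldMap_relFrobenius_functionFieldMap_twistFst
    (π : (A.frobeniusTwist p n).X.left ⟶ A.X.left) (hπ : π = twistFst p n A.X) [IsDominant π]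
    [IsDominant (Hom.toSchemeHom (A.relFrobenius p n))] (f : A.X.left.functionField) :
    functionFieldMap (Hom.toSchemeHom (A.relFrobenius p n)) (functionFieldMap π f) = f ^ p ^ n := by
  have hcomp : Hom.toSchemeHom (A.relFrobenius p n) ≫ π = absFrobeniusOver p n A.X := by
    rw [hπ]
    exact A.toSchemeHom_relFrobenius_comp_twistFst p n
  haveI : IsDominant (Hom.toSchemeHom (A.relFrobenius p n) ≫ π) := inferInstance
  rw [← RingHom.comp_apply, ← functionFieldMap_comp]
  exact functionFieldMap_powEndo A.X.left (p ^ n) _ _ (Hom.toSchemeHom (A.relFrobenius p n) ≫ π) hcomp f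

end AbelianVariety

/-! ## §4 `[K : K^q] = q^{trdeg_k K}` over a perfect field -/

section PDegree

variable {k : Type*} {K : Type*} [Field k] [Field K] [Algebra k K]

/-- **`[K : K^{pⁿ}] = p^{n · trdeg_k K}`** for a finitely generated field extension `K` of a perfect field `k` of
exponential characteristic `p` (the tower `K ⊇ K^p ⊇ K^{p²} ⊇ ⋯`, each storey `[K^{pⁱ} : K^{pⁱ⁺¹}] = [K : K^p]
= p^{trdeg}` by Matsumura Thm. 26.5 transported along the isomorphism `Frobⁱ : K ≅ K^{pⁱ}`; for `p = 1` both sides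
are `1`). [cite: Matsumura1987, Thm. 26.5] -/
theorem finrank_fieldRange_iterateFrobenius_eq_pow (p : ℕ) [ExpChar K p] [PerfectField k]
    [Algebra.EssFiniteType k K] {g : ℕ} (htr : Algebra.trdeg k K = g) (n : ℕ) :
    Module.finrank (iterateFrobenius K p n).fieldRange K = p ^ (n * g) := by
  -- `finrank ⊤ K = 1`
  have htop : ∀ φ : K →+* K, φ = RingHom.id K → Module.finrank φ.fieldRange K = 1 := by
    rintro φ rfl
    rw [RingHom.fieldRange_eq_top_iff.mpr Function.surjective_id, ← Subfield.relfinrank_top_right,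
      Subfield.relfinrank_top_left]
  cases ‹ExpChar K p› with
  | zero =>
    rw [one_pow]
    exact htop _ (RingHom.ext fun x => by rw [iterateFrobenius_def, one_pow, pow_one, RingHom.id_apply])
  | prime hp =>
    haveI := Fact.mk hp
    induction n with
    | zero =>
      rw [Nat.zero_mul, pow_zero]
      exact htop _ (iterateFrobenius_zero K p)
    | succ n ih =>
      -- `K_{n+1} ≤ K_n`
      have hle : (iterateFrobenius K p (n + 1)).fieldRange ≤ (iterateFrobenius K p n).fieldRange := by
        rintro _ ⟨x, rfl⟩
        exact ⟨frobenius K p x, by rw [iterateFrobenius_add_apply, iterateFrobenius_one_apply, frobenius_def]⟩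
      -- the storey `[K_n : K_{n+1}] = [K : K^p]`, transported along `Frobⁿ`
      have hstorey : Subfield.relfinrank (iterateFrobenius K p (n + 1)).fieldRange
          (iterateFrobenius K p n).fieldRange = p ^ g := by
        have h1 : (iterateFrobenius K p (n + 1)).fieldRange =
            (frobenius K p).fieldRange.map (iterateFrobenius K p n) := by
          rw [RingHom.map_fieldRange, ← iterateFrobenius_one (R := K) p, ← iterateFrobenius_add]
        have h2 : (iterateFrobenius K p n).fieldRange = (⊤ : Subfield K).map (iterateFrobenius K p n) :=
          RingHom.fieldRange_eq_map _
        rw [h1, h2, Subfield.relfinrank_map_map, Subfield.relfinrank_top_right]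
        exact Literature.FieldTheory.Separability.finrank_frobenius_eq_pow_of_trdeg_eq p htr
      have htower := Subfield.relfinrank_mul_finrank_top hle
      rw [hstorey, ih] at htower
      rw [← htower, Nat.succ_mul, pow_add, mul_comm]

end PDegree

/-! ## §5 `deg F_{A/k} = q^{dim A}` over a perfect field -/

namespace AbelianVariety

open RatFn

variable {k : Type u} [Field k] (p : ℕ) [ExpChar k p] (n : ℕ) (A : AbelianVariety k)

/-- `functionFieldMap` only depends on the morphism (instance-insensitive congruence). [folklore] -/
private theorem functionFieldMap_congr' {X Y : Scheme.{u}} [IsIntegral X] [IsIntegral Y] {f g : X ⟶ Y}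
    [IsDominant f] [IsDominant g] (h : f = g) : functionFieldMap f = functionFieldMap g := by
  subst h; rfl

/-- The comorphism `π^♯ : K(Y) → K(X)` of an ISOMORPHISM of integral schemes is bijective. [folklore] -/
private theorem functionFieldMap_bijective_of_isIso {X Y : Scheme.{u}} [IsIntegral X] [IsIntegral Y] (π : X ⟶ Y)
    [IsIso π] [IsDominant π] : Function.Bijective (functionFieldMap π) := by
  haveI : IsDominant (inv π) := inferInstance
  haveI : IsDominant (π ≫ inv π) := inferInstance
  haveI : IsDominant (inv π ≫ π) := inferInstance
  refine ⟨(functionFieldMap π).injective, fun y => ⟨functionFieldMap (inv π) y, ?_⟩⟩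
  rw [← RingHom.comp_apply, ← functionFieldMap_comp, functionFieldMap_congr' (IsIso.hom_inv_id π),
    functionFieldMap_id, RingHom.id_apply]

/-- **The image of `F_{A/k}^♯ : K(A^{(q)}) → K(A)` is `K(A)^q = {f^q}`** when `k` is perfect (then `pr^♯` is onto,
`pr` being an isomorphism of schemes, and `F^♯ ∘ pr^♯ = (f ↦ f^q)`) — Shimura §2.8 Prop. 6: «`k(x^q) = k(x)^q`»; the
`range` inequality consumed by the rational-factorisation lemma of the E2 road. [cite: Shimura1998, §2.8 Prop. 6 (p. 16) and §18.6 proof of Thm. 18.6 (p. 127)] -/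
theorem mem_range_functionFieldMap_relFrobenius_iff [PerfectField k]
    [IsDominant (Hom.toSchemeHom (A.relFrobenius p n))] (g : A.X.left.functionField) :
    g ∈ (functionFieldMap (Hom.toSchemeHom (A.relFrobenius p n))).range ↔ ∃ f, f ^ p ^ n = g := by
  haveI : PerfectRing k p := PerfectField.toPerfectRing p
  obtain ⟨π, hπ⟩ : ∃ π : (A.frobeniusTwist p n).X.left ⟶ A.X.left, π = twistFst p n A.X := ⟨_, rfl⟩
  haveI : IsIso π := by rw [hπ]; exact isIso_twistFst p n A.X
  haveI : IsDominant π := inferInstance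
  constructor
  · rintro ⟨y, rfl⟩
    obtain ⟨f, rfl⟩ := (functionFieldMap_bijective_of_isIso π).2 y
    exact ⟨f, (A.functionFieldMap_relFrobenius_functionFieldMap_twistFst p n π hπ f).symm⟩
  · rintro ⟨f, rfl⟩
    exact ⟨functionFieldMap π f, A.functionFieldMap_relFrobenius_functionFieldMap_twistFst p n π hπ f⟩

/-- The same as an equality of subrings of `K(A)`: `range F^♯ = range (f ↦ f^q)` (`q = pⁿ`, `k` perfect; `K(A)` has
exponential characteristic `p` through any ring map from `k`). [cite: Shimura1998, §2.8 Prop. 6 (p. 16) and §18.6 proof of Thm. 18.6 (p. 127)] -/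
theorem range_functionFieldMap_relFrobenius [PerfectField k] [IsDominant (Hom.toSchemeHom (A.relFrobenius p n))]
    [ExpChar A.X.left.functionField p] :
    (functionFieldMap (Hom.toSchemeHom (A.relFrobenius p n))).range =
      (iterateFrobenius A.X.left.functionField p n).range := by
  ext g
  rw [A.mem_range_functionFieldMap_relFrobenius_iff p n g, RingHom.mem_range]
  simp only [iterateFrobenius_def]

/-- **`trdeg_k K(A) = dim A`** for the `k`-algebra structure `k = Γ(Spec k) → Γ(A, ⊤) → K(A)` (germ at the generic
point) — Görtz–Wedhorn I Thm. 5.22 (3) (`height_top_eq_trdeg`) with `dim A = height` of the generic point.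
[cite: GortzWedhorn2020, Thm. 5.22 (3)] -/
theorem trdeg_functionField_eq_dim :
    letI := ((A.X.left.presheaf.germ ⊤ (genericPoint A.X.left) trivial).hom.comp
      (A.X.hom.appTop.hom.comp (Scheme.ΓSpecIso (.of k)).inv.hom)).toAlgebra
    Algebra.trdeg k A.X.left.functionField = A.dim := by
  letI algK := ((A.X.left.presheaf.germ ⊤ (genericPoint A.X.left) trivial).hom.comp
      (A.X.hom.appTop.hom.comp (Scheme.ΓSpecIso (.of k)).inv.hom)).toAlgebra
  have hlt := trdeg_functionField_lt_aleph0 A.X.hom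
  have h := height_top_eq_trdeg A.X.hom
  have hdim : ((Order.height (⊤ : A.X.left) : ℕ∞) : WithBot ℕ∞) = (A.dim : WithBot ℕ∞) := by
    rw [show (⊤ : A.X.left) = genericPoint A.X.left from rfl, Scheme.height_genericPoint, topologicalKrullDim_left]
  rw [hdim] at h
  have h' : (Cardinal.toNat (Algebra.trdeg k A.X.left.functionField) : WithBot ℕ∞) = (A.dim : ℕ) := h.symm
  have h'' : Cardinal.toNat (Algebra.trdeg k A.X.left.functionField) = A.dim := by exact_mod_cast h'
  rw [← h'', Cardinal.cast_toNat_of_lt_aleph0 hlt]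

/-- `K(A)` is essentially of finite type over `k` (for the `k`-algebra structure through `Γ(A, ⊤)`): a localisation
of an affine chart, a finitely generated `k`-algebra («`K(Y)` is a finitely generated extension field of `k`»).
[cite: Hartshorne1977, I Thm. 3.2 (d)] -/
theorem essFiniteType_functionField :
    letI := ((A.X.left.presheaf.germ ⊤ (genericPoint A.X.left) trivial).hom.comp
      (A.X.hom.appTop.hom.comp (Scheme.ΓSpecIso (.of k)).inv.hom)).toAlgebra
    Algebra.EssFiniteType k A.X.left.functionField := by
  letI algK := ((A.X.left.presheaf.germ ⊤ (genericPoint A.X.left) trivial).hom.comp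
      (A.X.hom.appTop.hom.comp (Scheme.ΓSpecIso (.of k)).inv.hom)).toAlgebra
  -- an affine chart `Spec R` containing the generic point
  obtain ⟨_, ⟨U, hU, rfl⟩, hηU, -⟩ :=
    A.X.left.isBasis_affineOpens.exists_subset_of_mem_open (Set.mem_univ (⊤ : A.X.left)) isOpen_univ
  have hU : IsAffineOpen U := hU
  haveI : Nonempty U := ⟨⟨⊤, hηU⟩⟩
  let ι : k →+* Γ(Spec (CommRingCat.of k), ⊤) := (Scheme.ΓSpecIso (CommRingCat.of k)).inv.hom
  let φU : k →+* Γ(A.X.left, U) := (A.X.hom.appLE ⊤ U le_top).hom.comp ι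
  letI algU : Algebra k Γ(A.X.left, U) := φU.toAlgebra
  haveI : Algebra.FiniteType k Γ(A.X.left, U) := by
    have h1 : (A.X.hom.appLE ⊤ U le_top).hom.FiniteType :=
      A.X.hom.finiteType_appLE (isAffineOpen_top _) hU le_top
    have h2 : ι.FiniteType :=
      RingHom.FiniteType.of_surjective _
        (Scheme.ΓSpecIso (CommRingCat.of k)).symm.commRingCatIsoToRingEquiv.surjective
    exact h1.comp h2
  haveI : IsFractionRing Γ(A.X.left, U) A.X.left.functionField :=
    functionField_isFractionRing_of_isAffineOpen A.X.left U hU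
  haveI : IsScalarTower k Γ(A.X.left, U) A.X.left.functionField := by
    refine IsScalarTower.of_algebraMap_eq fun c ↦ ?_
    change (A.X.left.presheaf.germ ⊤ (genericPoint A.X.left) trivial) (A.X.hom.appTop (ι c)) =
      A.X.left.germToFunctionField U ((A.X.hom.app ⊤ ≫ A.X.left.presheaf.map (homOfLE le_top).op) (ι c))
    have hres := TopCat.Presheaf.germ_res A.X.left.presheaf (homOfLE (le_top : U ≤ ⊤)) (genericPoint A.X.left)
      hηU
    rw [Scheme.germToFunctionField, ← hres]
    rfl
  haveI : Algebra.EssFiniteType Γ(A.X.left, U) A.X.left.functionField :=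
    Algebra.EssFiniteType.of_isLocalization _ (nonZeroDivisors Γ(A.X.left, U))
  exact Algebra.EssFiniteType.comp k Γ(A.X.left, U) A.X.left.functionField

/-- **`deg F_{A/k} = q^{dim A}`** (`q = pⁿ`, `k` perfect): the order of the kernel of the relative `q`-Frobenius of
a `g`-dimensional abelian variety is `q^g`.  Proof: `deg = [K(A) : F^♯ K(A^{(q)})]`
(`IsIsogeny.kerRank_eq_finrank_functionFieldOver`); `pr^♯ : K(A) ≅ K(A^{(q)})` (`pr` is an isomorphism of schemes,
`isIso_twistFst`) with `F^♯ ∘ pr^♯ = (f ↦ f^q)` (§3), so the degree is `[K(A) : K(A)^q] = q^{trdeg_k K(A)} = q^{dim A}`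
(§4, `trdeg_functionField_eq_dim`). [cite: MumfordAV1970, §15 (p. 146)] [cite: Shimura1998, §2.8 Prop. 6 (p. 16) and §18.6 proof of Thm. 18.6 (p. 127)] -/
theorem kerRank_relFrobenius [PerfectField k] : Hom.kerRank (A.relFrobenius p n) = p ^ (n * A.dim) := by
  have hF := A.isIsogeny_relFrobenius p n
  haveI := hF.1
  haveI := hF.2
  haveI := hF.flat
  haveI : IsDominant (Hom.toSchemeHom (A.relFrobenius p n)) := inferInstance
  haveI : PerfectRing k p := PerfectField.toPerfectRing p
  -- the projection `π = pr : A^{(q)} → A`, an isomorphism of schemes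
  obtain ⟨π, hπ⟩ : ∃ π : (A.frobeniusTwist p n).X.left ⟶ A.X.left, π = twistFst p n A.X := ⟨_, rfl⟩
  haveI : IsIso π := by rw [hπ]; exact isIso_twistFst p n A.X
  haveI : IsDominant π := inferInstance
  rw [hF.kerRank_eq_finrank_functionFieldOver]
  -- notation; `K(A)` has exponential characteristic `p` (it receives a ring map from the field `k`)
  set K := A.X.left.functionField with hK
  letI algK := ((A.X.left.presheaf.germ ⊤ (genericPoint A.X.left) trivial).hom.comp
      (A.X.hom.appTop.hom.comp (Scheme.ΓSpecIso (.of k)).inv.hom)).toAlgebra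
  haveI : ExpChar K p := expChar_of_injective_algebraMap (algebraMap k K).injective p
  let φ : K →+* K := iterateFrobenius K p n
  -- `e := π^♯ : K(A) ≃ K(A^{(q)})` and `ρ : K ≃ φ(K)`
  let e : K ≃+* (A.frobeniusTwist p n).X.left.functionField :=
    RingEquiv.ofBijective (functionFieldMap π) (functionFieldMap_bijective_of_isIso π)
  let ρ : K ≃+* φ.fieldRange := φ.rangeRestrictFieldEquiv
  -- `F^♯ (e f) = φ f`
  have hFe : ∀ f : K, functionFieldMap (Hom.toSchemeHom (A.relFrobenius p n)) (e f) = φ f := fun f =>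
    A.functionFieldMap_relFrobenius_functionFieldMap_twistFst p n π hπ f
  -- Steps 1–2: `[K(A) : F^♯ K(A^{(q)})] = [K : φ(K)]`, transporting the scalars along `φ(K) ≃ K ≃ K(A^{(q)})`
  have step : Module.finrank φ.fieldRange K = Module.finrank (A.frobeniusTwist p n).X.left.functionField
      (FunctionFieldOver (Hom.toSchemeHom (A.relFrobenius p n))) := by
    refine Algebra.finrank_eq_of_equiv_equiv (ρ.symm.trans e)
      (FunctionFieldOver.of (Hom.toSchemeHom (A.relFrobenius p n))) ?_
    ext y
    change functionFieldMap (Hom.toSchemeHom (A.relFrobenius p n)) (e (ρ.symm y)) = (y : K)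
    rw [hFe]
    exact φ.rangeRestrictFieldEquiv_apply_symm_apply y
  rw [← step]
  -- Step 3: `[K : K^q] = q^{trdeg} = q^{dim}`
  haveI := A.essFiniteType_functionField
  exact finrank_fieldRange_iterateFrobenius_eq_pow p (A.trdeg_functionField_eq_dim) n

end AbelianVariety

end Literature.AlgebraicGeometry.Motives

end
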